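import Summits.ResolutionOfSingularities.ResolutionOfSingularities.Theorems.PurelyInseparableDim4JointForestWaitingTwoMembers
import HarnessLib

/-!
# Purely inseparable four-folds: computations for TWO HOSTS each with its own WAITING MEMBER —
# `F_ε = x₁^{2p} x₄ + ε x₁^p x₄ + x₁² x₂^{p−1} x₃^{p−1} + ε x₁ x₂^{p−1} x₃^{p−1}` (brick S3 (c) «joint point∘coordinate chains», part 57a;
# cell `res-dim4-pi`)

[OURS · counted 0] (D-0157 DOOR 2; desk WORD #66 (4)(c), #74 (g), #99 (d); frame `PIDim4.TerminationImpliesOrderReduction`, S3 (c) v3;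
host item stmt-ResolutionOfSingularities-16155, helper). Nothing here proves resolution of singularities in dimension ≥ 4 / characteristic
`p` — NOT here, not anywhere in this programme. Pure polynomial computations for part 57 (the two-hosts certificate of part 55):
for `ε ≠ 0` (root `ε = −1`; the second host re-centred at `x₁ = 1` gives `ε = +1`):

* the order-`p` locus of `z^p + F_{−1}` is `V(z, x₁, x₂) ∪ V(z, x₁, x₃) ∪ V(z, x₁ − 1, x₂) ∪ V(z, x₁ − 1, x₃)` (`roots_twoHosts`: a root of
  all low-order coefficients has `x₁ ∈ {0, 1}` and `x₂ x₃ = 0`);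
* hosts `S = {x₁, x₂}` and waiting sets `T = {x₁, x₃}` are permissible for `F_ε`; `F_{−1}(x + e₁) = F_{+1}`;
* host chart `x₁`: dead (`∂_{x₄} = ε`); host chart `x₂`: `F_ε ↦ H_ε = y₁^{2p} y₂^p y₄ + ε y₁^p y₄ + y₁² y₂ y₃^{p−1} + ε y₁ y₃^{p−1}`, whose
  equimultiple points on the divisor have `y₁ = y₃ = 0` (the waiting kid `T = {y₁, y₃}`);
* the waiting kid's blow-up along `T`: both charts dead (`∂_{y₄} = ε`, `∂_{y₁} = ε`).

AI-produced formalisation, weaker than expert review. bears_on: LADDER-RESOLUTION:D157-DOOR2 (res-dim4-pi · S3 (c) joint v3 · instance).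
-/

set_option linter.dupNamespace false -- D-0017: single-problem summit path `Summit.<S>.<S>.…` by design

noncomputable section

open MvPolynomial Finset

namespace Summit.ResolutionOfSingularities.ResolutionOfSingularities.Theorems.PIDim4

open Literature.AlgebraicGeometry.Resolution
open Literature.AlgebraicGeometry.Resolution.Hauser2010
open Literature.AlgebraicGeometry.Resolution.AffinePointBlowup (P A γ coord Wtop ξ)

namespace Equimultiple

section TwoHostsComputations

variable {K : Type} [Field K] {p : ℕ} [hp : Fact p.Prime] [CharP K p]

/-! ## §1 Monomial forms -/

omit hp [CharP K p] in
/-- `c · x₁^a x₂^b x₃^c x₄^d` as a monomial. [folklore] -/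
theorem C_mul_X_pow_four (r : K) (a b c d : ℕ) :
    (C r * (X 0 ^ a * X 1 ^ b * X 2 ^ c * X 3 ^ d) : MvPolynomial (Fin 4) K) =
      monomial (Finsupp.single 0 a + Finsupp.single 1 b + Finsupp.single 2 c + Finsupp.single 3 d) r := by
  rw [X_pow_eq_monomial, X_pow_eq_monomial, X_pow_eq_monomial, X_pow_eq_monomial, monomial_mul, monomial_mul, monomial_mul,
    C_mul_monomial, mul_one, mul_one, mul_one, mul_one]

omit hp [CharP K p] in
/-- `F_ε` in four-exponent form. [folklore] -/
theorem twoHosts_eq (ε : K) :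
    (X 0 ^ (2 * p) * X 3 + C ε * (X 0 ^ p * X 3) + X 0 ^ 2 * X 1 ^ (p - 1) * X 2 ^ (p - 1) +
        C ε * (X 0 * X 1 ^ (p - 1) * X 2 ^ (p - 1)) : MvPolynomial (Fin 4) K) =
      C 1 * (X 0 ^ (2 * p) * X 1 ^ 0 * X 2 ^ 0 * X 3 ^ 1) + C ε * (X 0 ^ p * X 1 ^ 0 * X 2 ^ 0 * X 3 ^ 1) +
        C 1 * (X 0 ^ 2 * X 1 ^ (p - 1) * X 2 ^ (p - 1) * X 3 ^ 0) + C ε * (X 0 ^ 1 * X 1 ^ (p - 1) * X 2 ^ (p - 1) * X 3 ^ 0) := by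
  simp only [pow_zero, pow_one, mul_one, C_1, one_mul]

omit hp [CharP K p] in
/-- The support of `F_ε` lies in its four exponents. [folklore] -/
theorem mem_support_twoHosts (ε : K) {e : Fin 4 →₀ ℕ}
    (he : e ∈ (X 0 ^ (2 * p) * X 3 + C ε * (X 0 ^ p * X 3) + X 0 ^ 2 * X 1 ^ (p - 1) * X 2 ^ (p - 1) +
        C ε * (X 0 * X 1 ^ (p - 1) * X 2 ^ (p - 1)) : MvPolynomial (Fin 4) K).support) :
    e = Finsupp.single 0 (2 * p) + Finsupp.single 1 0 + Finsupp.single 2 0 + Finsupp.single 3 1 ∨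
      e = Finsupp.single 0 p + Finsupp.single 1 0 + Finsupp.single 2 0 + Finsupp.single 3 1 ∨
      e = Finsupp.single 0 2 + Finsupp.single 1 (p - 1) + Finsupp.single 2 (p - 1) + Finsupp.single 3 0 ∨
      e = Finsupp.single 0 1 + Finsupp.single 1 (p - 1) + Finsupp.single 2 (p - 1) + Finsupp.single 3 0 := by
  rw [twoHosts_eq, C_mul_X_pow_four, C_mul_X_pow_four, C_mul_X_pow_four, C_mul_X_pow_four] at he
  rcases Finset.mem_union.mp (Finset.mem_of_subset MvPolynomial.support_add he) with h | h
  · rcases Finset.mem_union.mp (Finset.mem_of_subset MvPolynomial.support_add h) with h | h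
    · rcases Finset.mem_union.mp (Finset.mem_of_subset MvPolynomial.support_add h) with h | h
      · exact Or.inl (Finset.mem_singleton.mp (Finset.mem_of_subset support_monomial_subset h))
      · exact Or.inr (Or.inl (Finset.mem_singleton.mp (Finset.mem_of_subset support_monomial_subset h)))
    · exact Or.inr (Or.inr (Or.inl (Finset.mem_singleton.mp (Finset.mem_of_subset support_monomial_subset h))))
  · exact Or.inr (Or.inr (Or.inr (Finset.mem_singleton.mp (Finset.mem_of_subset support_monomial_subset h))))

omit [CharP K p] in
/-- **`F_ε` is clean** (`x₄` has exponent `1` in the first two monomials, `x₂` has exponent `p − 1` in the other two).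
[cite: HauserPerlega2019PRIMS, §2 (cleaning)] -/
theorem isClean_twoHosts (ε : K) :
    Literature.Barriers.ResolutionOfSingularities.HauserPerlega.IsClean p
      (X 0 ^ (2 * p) * X 3 + C ε * (X 0 ^ p * X 3) + X 0 ^ 2 * X 1 ^ (p - 1) * X 2 ^ (p - 1) +
        C ε * (X 0 * X 1 ^ (p - 1) * X 2 ^ (p - 1)) : MvPolynomial (Fin 4) K) := by
  intro d hd hpth
  have hp1 : 1 < p := hp.out.one_lt
  have key1 : ∀ i : Fin 4, d i = 1 → False := fun i hi => by
    have h := hpth i (by rw [Finsupp.mem_support_iff, hi]; exact one_ne_zero)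
    rw [hi] at h
    exact hp1.ne' (Nat.dvd_one.mp h)
  have key2 : ∀ i : Fin 4, d i = p - 1 → False := fun i hi => by
    have h := hpth i (by rw [Finsupp.mem_support_iff, hi]; omega)
    rw [hi] at h
    exact absurd (Nat.le_of_dvd (by omega) h) (by omega)
  rcases mem_support_twoHosts ε hd with rfl | rfl | rfl | rfl
  · exact key1 3 (by simp)
  · exact key1 3 (by simp)
  · exact key2 1 (by simp)
  · exact key2 1 (by simp)

omit [CharP K p] in
/-- `F_{−1} ≠ 0`. [folklore] -/
theorem twoHosts_ne_zero :
    (X 0 ^ (2 * p) * X 3 + C (-1) * (X 0 ^ p * X 3) + X 0 ^ 2 * X 1 ^ (p - 1) * X 2 ^ (p - 1) +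
        C (-1) * (X 0 * X 1 ^ (p - 1) * X 2 ^ (p - 1)) : MvPolynomial (Fin 4) K) ≠ 0 := by
  intro h
  have hc := congrArg (coeff (Finsupp.single (0 : Fin 4) 1 + Finsupp.single 1 (p - 1) + Finsupp.single 2 (p - 1) +
    Finsupp.single 3 0)) h
  have hp1 : 1 < p := hp.out.one_lt
  rw [twoHosts_eq, C_mul_X_pow_four, C_mul_X_pow_four, C_mul_X_pow_four, C_mul_X_pow_four, coeff_add, coeff_add, coeff_add,
    coeff_monomial, coeff_monomial, coeff_monomial, coeff_monomial, if_neg, if_neg, if_neg, if_pos rfl, coeff_zero] at hc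
  · simp at hc
  · intro h'; have := DFunLike.congr_fun h' 0; simp at this
  · intro h'; have := DFunLike.congr_fun h' 3; simp at this
  · intro h'; have := DFunLike.congr_fun h' 3; simp at this

omit hp [CharP K p] in
/-- **`V(z, x₁, x₂)` is Hironaka-permissible for `z^p + F_ε`** (the hosts). [cite: HauserPerlega2019PRIMS, §2 (condition (1))] -/
theorem isPermissibleCentre_S_twoHosts (ε : K) :
    IsPermissibleCentre p ({0, 1} : Finset (Fin 4))
      (X 0 ^ (2 * p) * X 3 + C ε * (X 0 ^ p * X 3) + X 0 ^ 2 * X 1 ^ (p - 1) * X 2 ^ (p - 1) +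
        C ε * (X 0 * X 1 ^ (p - 1) * X 2 ^ (p - 1)) : MvPolynomial (Fin 4) K) := by
  refine ⟨⟨0, by simp⟩, Finset.le_inf fun d hd => ?_⟩
  rcases mem_support_twoHosts ε hd with rfl | rfl | rfl | rfl <;>
    simp [CentreBlowup.degIn_pair (show (0 : Fin 4) ≠ 1 by decide)] <;> norm_cast <;> omega

omit hp [CharP K p] in
/-- **`V(z, x₁, x₃)` is Hironaka-permissible for `z^p + F_ε`** (the waiting members). [cite: HauserPerlega2019PRIMS, §2 (condition (1))] -/
theorem isPermissibleCentre_T_twoHosts (ε : K) :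
    IsPermissibleCentre p ({0, 2} : Finset (Fin 4))
      (X 0 ^ (2 * p) * X 3 + C ε * (X 0 ^ p * X 3) + X 0 ^ 2 * X 1 ^ (p - 1) * X 2 ^ (p - 1) +
        C ε * (X 0 * X 1 ^ (p - 1) * X 2 ^ (p - 1)) : MvPolynomial (Fin 4) K) := by
  refine ⟨⟨0, by simp⟩, Finset.le_inf fun d hd => ?_⟩
  rcases mem_support_twoHosts ε hd with rfl | rfl | rfl | rfl <;>
    simp [CentreBlowup.degIn_pair (show (0 : Fin 4) ≠ 2 by decide)] <;> norm_cast <;> omega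

/-- **`F_{−1}(x + e₁) = F_{+1}`** (the second host re-centred: `(x₁ + 1)^p = x₁^p + 1`). [cite: Hauser2010, §F (translation)] -/
theorem translate_e₀_twoHosts :
    PointBlowup.translate (Pi.single 0 1 : Fin 4 → K)
        (X 0 ^ (2 * p) * X 3 + C (-1) * (X 0 ^ p * X 3) + X 0 ^ 2 * X 1 ^ (p - 1) * X 2 ^ (p - 1) +
          C (-1) * (X 0 * X 1 ^ (p - 1) * X 2 ^ (p - 1)) : MvPolynomial (Fin 4) K) =
      X 0 ^ (2 * p) * X 3 + C 1 * (X 0 ^ p * X 3) + X 0 ^ 2 * X 1 ^ (p - 1) * X 2 ^ (p - 1) +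
        C 1 * (X 0 * X 1 ^ (p - 1) * X 2 ^ (p - 1)) := by
  unfold PointBlowup.translate
  simp only [map_add, map_mul, map_pow, aeval_X, aeval_C, algebraMap_eq, Pi.single_eq_same, C_1,
    Pi.single_eq_of_ne (show (1 : Fin 4) ≠ 0 by decide), Pi.single_eq_of_ne (show (2 : Fin 4) ≠ 0 by decide),
    Pi.single_eq_of_ne (show (3 : Fin 4) ≠ 0 by decide), C_0, add_zero]
  rw [mul_comm 2 p, pow_mul, pow_mul, add_pow_char, one_pow, map_neg, C_1]
  ring

/-- **The root parameters**: a root `b` of all low-order coefficients of `F_{−1}(x + b)` has `b₁ ∈ {0, 1}` (`∂_{x₄} = x₁^{2p} − x₁^p`)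
and `b₂ = 0 ∨ b₃ = 0` (`∂_{x₁} = (2x₁ − 1) x₂^{p−1} x₃^{p−1}`, `2b₁ − 1 = ∓1`). [cite: Hauser2010, §F (equiconstant points)] -/
theorem roots_twoHosts (b : Fin 4 → K)
    (H : ∀ d : Fin 4 →₀ ℕ, d ≠ 0 → d.degree < p → coeff d (PointBlowup.translate b
      (X 0 ^ (2 * p) * X 3 + C (-1) * (X 0 ^ p * X 3) + X 0 ^ 2 * X 1 ^ (p - 1) * X 2 ^ (p - 1) +
        C (-1) * (X 0 * X 1 ^ (p - 1) * X 2 ^ (p - 1)) : MvPolynomial (Fin 4) K)) = 0) :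
    (b 0 = 0 ∨ b 0 = 1) ∧ (b 1 = 0 ∨ b 2 = 0) := by
  have hp0 : p ≠ 0 := hp.out.ne_zero
  have hp1 : p - 1 ≠ 0 := by have := hp.out.one_lt; omega
  have h3 := eval_pderiv_eq_zero_of_forall_coeff b _ H 3
  have h0 := eval_pderiv_eq_zero_of_forall_coeff b _ H 0
  simp [(pderiv (3 : Fin 4)).leibniz_pow, (pderiv (0 : Fin 4)).leibniz_pow] at h3 h0
  have h01 : b 0 = 0 ∨ b 0 = 1 := by
    apply eq_zero_or_one_of_pow
    rw [pow_mul'] at h3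
    linear_combination h3
  refine ⟨h01, ?_⟩
  have hu : (2 * b 0 - 1 : K) ≠ 0 := by
    rcases h01 with h | h
    · rw [h, mul_zero, zero_sub]; exact neg_ne_zero.mpr one_ne_zero
    · rw [h, mul_one, show (2 - 1 : K) = 1 by ring]; exact one_ne_zero
  have key : (2 * b 0 - 1) * (b 1 ^ (p - 1) * b 2 ^ (p - 1)) = 0 := by linear_combination h0
  rcases mul_eq_zero.mp key with h | h
  · exact absurd h hu
  · rcases mul_eq_zero.mp h with h | h
    · exact Or.inl (pow_eq_zero_iff hp1 |>.mp h)
    · exact Or.inr (pow_eq_zero_iff hp1 |>.mp h)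

end TwoHostsComputations

end Equimultiple

end Summit.ResolutionOfSingularities.ResolutionOfSingularities.Theorems.PIDim4

end
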